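import Summits.CriticalPhenomena.Ising3DConformalLimit.Theorems.MonotoneBlockingLimitsAreConformalSplit
import Literature.Probability.LatticeModels.PointwiseScalingLimitScale
import Literature.Probability.LatticeModels.CriticalScalingDimension
import HarnessLib

/-!
# `LimitsAreConformal` (item stmt-CriticalPhenomena-6154) is EXACTLY "existence ⟹ the sub-problem"

Crux `MonotoneBlocking.LimitsAreConformal` (LAC; shared verbatim with `MirrorHoelderCompactness.LimitsAreConformal`):
every normalised, non-degenerate, translation-invariant, scale-covariant pointwise scaling limit of
`criticalCorr 3` is `O(3)`-invariant, inversion covariant with the same `Δ`, and non-Gaussian.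

Main results (pure assembly over landed theorems; no definitions, no `sorry`):

* `moebiusLimitExists_of_summit` — the sub-problem statement `Ising3DConformalLimit` gives crux 1344
  `PerfectScreening.MoebiusLimitExists` (forget `U₄`);
* `nonGaussian_of_summit` — `Ising3DConformalLimit → IsingEuclidUpgradeR4NonGaussian` (item 0636): all
  non-degenerate pointwise limits of one lattice family are proportional (`exists_scale_of_isNondegenerateTwoPoint`)
  and `U₄ ≢ 0` is scale-free (`hasNontrivialU4_iff_of_scale`);
* `limitsAreConformal_of_summit : Ising3DConformalLimit → LimitsAreConformal` — the crux is NECESSARY for the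
  sub-problem (via the landed `inversionUpgradeNormalised_of_MoebiusLimitExists` and the split glue
  `LimitsAreConformal_of_subs`), so a refutation of LAC would refute the sub-problem itself;
* `summit_of_existsScaleCovariantLimit` — LAC + existence (item 1981 `ExistsScaleCovariantLimit`) give the
  sub-problem (`0 < Δ` is free: `scalingDimension_mem_Icc_holds`, `1/2 ≤ Δ ≤ 1`);
* `limitsAreConformal_iff_exists_imp_summit : LimitsAreConformal ↔ (ExistsScaleCovariantLimit → Ising3DConformalLimit)`
  — THE LOCATION OF THE CRUX: it is exactly the implication "existence ⟹ conformal limit", the complement of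
  item 1981 inside the sub-problem; in particular it is vacuous-or-true unless a scale-covariant limit exists, and
  refutable only by (existence ∧ ¬ sub-problem);
* `summit_iff_three_hubs : Ising3DConformalLimit ↔ ExistsScaleCovariantLimit ∧ InversionUpgradeNormalised ∧
  IsingEuclidUpgradeR4NonGaussian` — with `LimitsAreConformal_iff_subs` (LAC ↔ 1982 ∧ 0636): the sub-problem is
  EXACTLY the three open hub items 1981 ∧ 1982 ∧ 0636 of route `HyperoctahedralRP` (rotations, item 1980, and
  two-point rigidity, item 1979, being theorems of the tree).

Provenance: `limitsAreConformal_of_summit` / `limitsAreConformal_iff_exists_imp_summit` are the refuter's vetting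
certificate of this crux (`Cruxes/LimitsAreConformal/Vetting.lean`, `refuter-rattack-stmt-CriticalPhenomena-6154-0`,
2026-08-17), re-proved here over the Literature uniqueness lemma instead of its private `limits_proportional`; landed
by the line lead of the crux (`--supports stmt-CriticalPhenomena-6154`, line `hub_conjuncts`).
References: H. Duminil-Copin, *100 years of the (critical) Ising model on the hypercubic lattice*, Proc. ICM 2022,
§8.1 p. 25, §8.4 p. 29 (existence / rotations / conformal invariance of the `ℤ³` limit: open).
-/

noncomputable section

namespace Summit.CriticalPhenomena.Ising3DConformalLimit.Theorems.LimitsAreConformalSummit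

open Literature.Probability.LatticeModels
open Summit.CriticalPhenomena.Ising3DConformalLimit.Theses
open Summit.CriticalPhenomena.Ising3DConformalLimit.Theorems.LimitsAreConformalSplit
open Summit.CriticalPhenomena.Ising3DConformalLimit.MoebiusLimitExistsOnlyInteraction

/-! ## §1 The sub-problem implies each hub item it mentions -/

/-- **Sub-problem ⟹ crux 1344** (`PerfectScreening.MoebiusLimitExists`): forget the non-Gaussianity clause. -/
theorem moebiusLimitExists_of_summit (h : _root_.Ising3DConformalLimit) :
    PerfectScreening.MoebiusLimitExists := by
  obtain ⟨ρ, Δ, S, hρ, hΔ, hlim, hnd, hM, -⟩ := h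
  exact ⟨ρ, Δ, S, hρ, hΔ, hlim, hnd, hM⟩

/-- **Sub-problem ⟹ item 1981** (`ExistsScaleCovariantLimit`): normalise the Möbius witness off the diagonals
(landed `existsScaleCovariantLimit_of_MoebiusLimitExists`). -/
theorem existsScaleCovariantLimit_of_summit (h : _root_.Ising3DConformalLimit) :
    HyperoctahedralRP.ExistsScaleCovariantLimit :=
  existsScaleCovariantLimit_of_MoebiusLimitExists (moebiusLimitExists_of_summit h)

/-- **Sub-problem ⟹ item 1982** (`InversionUpgradeNormalised`): inversion covariance transfers from the Möbius
witness to every normalised non-degenerate limit (landed `inversionUpgradeNormalised_of_MoebiusLimitExists`). -/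
theorem inversionUpgradeNormalised_of_summit (h : _root_.Ising3DConformalLimit) :
    HyperoctahedralRP.InversionUpgradeNormalised :=
  inversionUpgradeNormalised_of_MoebiusLimitExists (moebiusLimitExists_of_summit h)

/-- **Sub-problem ⟹ item 0636** (`IsingEuclidUpgradeR4NonGaussian`): two non-degenerate pointwise limits of
`criticalCorr 3` differ by a positive scale `κⁿ` on non-coincident configurations
(`HasPointwiseScalingLimit.exists_scale_of_isNondegenerateTwoPoint`), which does not affect `U₄ ≢ 0`
(`hasNontrivialU4_iff_of_scale`). -/
theorem nonGaussian_of_summit (h : _root_.Ising3DConformalLimit) :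
    HyperoctahedralRP.IsingEuclidUpgradeR4NonGaussian := by
  intro ρ S hρ hlim hnd
  obtain ⟨ρ₀, Δ₀, S₀, hρ₀, -, hlim₀, hnd₀, -, hU4₀⟩ := h
  obtain ⟨κ, hκ, hscale⟩ :=
    hlim₀.exists_scale_of_isNondegenerateTwoPoint (by norm_num : 0 < 3) hρ₀ hρ hlim hnd₀ hnd
  exact (hasNontrivialU4_iff_of_scale hκ.ne' hscale).2 hU4₀

/-! ## §2 The crux is necessary for the sub-problem -/

/-- **`S → C`: the sub-problem implies the crux.** `Ising3DConformalLimit → LimitsAreConformal`, by the split glue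
`LimitsAreConformal_of_subs` fed with `inversionUpgradeNormalised_of_summit` and `nonGaussian_of_summit`. Hence any
`¬ LimitsAreConformal` would be `¬ Ising3DConformalLimit`. -/
theorem limitsAreConformal_of_summit (h : _root_.Ising3DConformalLimit) : MonotoneBlocking.LimitsAreConformal :=
  LimitsAreConformal_of_subs (inversionUpgradeNormalised_of_summit h) (nonGaussian_of_summit h)

/-! ## §3 The crux + existence give the sub-problem -/

/-- **LAC + item 1981 ⟹ the sub-problem**: the witness of `ExistsScaleCovariantLimit` is upgraded by the crux to a
Möbius-covariant non-Gaussian limit; pack `IsMoebiusCovariant Δ S := ⟨⟨transl, rot⟩, scale, inversion⟩`. -/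
theorem summit_of_existsScaleCovariantLimit (hLAC : MonotoneBlocking.LimitsAreConformal)
    (hE : HyperoctahedralRP.ExistsScaleCovariantLimit) : _root_.Ising3DConformalLimit := by
  obtain ⟨ρ, Δ, S, hρ, hΔ, hlim, hnorm, hnd, htr, hsc⟩ := hE
  obtain ⟨hrot, hinv, hU4⟩ := hLAC ρ Δ S hρ hlim hnorm hnd htr hsc
  exact ⟨ρ, Δ, S, hρ, hΔ, hlim, hnd, ⟨⟨htr, hrot⟩, hsc, hinv⟩, hU4⟩

/-- **THE CRUX IS EXACTLY "EXISTENCE ⟹ SUB-PROBLEM".** `LimitsAreConformal ↔ (ExistsScaleCovariantLimit →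
Ising3DConformalLimit)` (`ExistsScaleCovariantLimit` = item stmt-CriticalPhenomena-1981, the conclusion of this
route's `BlockingGivesLimit`). `→`: `summit_of_existsScaleCovariantLimit`. `←`: given the crux hypotheses for
`(ρ, Δ, S)`, `0 < Δ` is free (`scalingDimension_mem_Icc_holds`: `1/2 ≤ Δ`), so `(ρ, Δ, S)` witnesses item 1981, the
implication yields the sub-problem, and `limitsAreConformal_of_summit` returns the three conclusions for THIS limit.
(Header written fully qualified on one line: it is the registered bookkeeping stub of this `--supports` file.) -/
theorem limitsAreConformal_iff_exists_imp_summit : Summit.CriticalPhenomena.Ising3DConformalLimit.Theses.MonotoneBlocking.LimitsAreConformal ↔ (Summit.CriticalPhenomena.Ising3DConformalLimit.Theses.HyperoctahedralRP.ExistsScaleCovariantLimit → _root_.Ising3DConformalLimit) := by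
  constructor
  · exact fun hLAC hE => summit_of_existsScaleCovariantLimit hLAC hE
  · intro h ρ Δ S hρ hlim hnorm hnd htr hsc
    have hΔ : 0 < Δ := by
      have := (scalingDimension_mem_Icc_holds ρ Δ S hlim hsc hnd hρ).1
      linarith
    exact limitsAreConformal_of_summit (h ⟨ρ, Δ, S, hρ, hΔ, hlim, hnorm, hnd, htr, hsc⟩)
      ρ Δ S hρ hlim hnorm hnd htr hsc

/-- The same location for the `MirrorHoelderCompactness` spelling of the crux (route
`route-CriticalPhenomena-MirrorHoelderCompactness`, rank 6; the same term). -/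
theorem mirror_limitsAreConformal_iff_exists_imp_summit :
    MirrorHoelderCompactness.LimitsAreConformal ↔
      (HyperoctahedralRP.ExistsScaleCovariantLimit → _root_.Ising3DConformalLimit) :=
  limitsAreConformal_iff_exists_imp_summit

/-! ## §4 The sub-problem is exactly the three open hub items -/

/-- **`Ising3DConformalLimit ↔ 1981 ∧ 1982 ∧ 0636`.** The sub-problem "the critical Ising model on `ℤ³` has a
Möbius-covariant non-Gaussian scaling limit" is EXACTLY the conjunction of the three open hub items of route
`HyperoctahedralRP`: existence of a normalised non-degenerate translation-invariant scale-covariant limit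
(`ExistsScaleCovariantLimit`, 1981), the inversion upgrade (`InversionUpgradeNormalised`, 1982) and non-triviality
(`IsingEuclidUpgradeR4NonGaussian`, 0636) — rotation invariance (1980) and two-point rigidity (1979) being theorems of
the tree. `→`: §1. `←`: `LimitsAreConformal_of_subs` then `summit_of_existsScaleCovariantLimit`. -/
theorem summit_iff_three_hubs :
    _root_.Ising3DConformalLimit ↔
      (HyperoctahedralRP.ExistsScaleCovariantLimit ∧ HyperoctahedralRP.InversionUpgradeNormalised ∧
        HyperoctahedralRP.IsingEuclidUpgradeR4NonGaussian) :=
  ⟨fun h => ⟨existsScaleCovariantLimit_of_summit h, inversionUpgradeNormalised_of_summit h, nonGaussian_of_summit h⟩,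
    fun h => summit_of_existsScaleCovariantLimit (LimitsAreConformal_of_subs h.2.1 h.2.2) h.1⟩

/-- **Given existence, the sub-problem IS the crux's content `1982 ∧ 0636`.** -/
theorem summit_iff_subs_of_exists (hE : HyperoctahedralRP.ExistsScaleCovariantLimit) :
    _root_.Ising3DConformalLimit ↔
      (HyperoctahedralRP.InversionUpgradeNormalised ∧ HyperoctahedralRP.IsingEuclidUpgradeR4NonGaussian) :=
  ⟨fun h => ⟨inversionUpgradeNormalised_of_summit h, nonGaussian_of_summit h⟩,
    fun h => summit_of_existsScaleCovariantLimit (LimitsAreConformal_of_subs h.1 h.2) hE⟩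

end Summit.CriticalPhenomena.Ising3DConformalLimit.Theorems.LimitsAreConformalSummit

end
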